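import Summits.QuantumAdvantage.QuantumAdvantage.Theorems.InnerDegreeLawsB
import Summits.QuantumAdvantage.QuantumAdvantage.Theses.AbsorptionDial
import HarnessLib

set_option linter.dupNamespace false

/-!
# LAW I (co-support law), part A — the engine (lens 4 «CoSupportDial», cell decomp-qadv, `--supports` X = item 28487
# `Theses.AbsorptionDial.NoPerfectPolyOdd`)

Registers of a strategy are tables of `k` linear forms `mod p` of ALL input bits and of an arbitrary CORE `N_g(u) ∈ W` that ignores the
bits of a register-dependent FREE set.  In characteristic two (`𝔽₂(μ_{3p})`, the tree's `Coset21.CharTwoKill` machinery) the fire count is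
a sum of ATOMS `[N_g u = w₀] · coef · χ_z(u)` (`card_fire_eq_WsumC`); the killing functional `Φ_γ` (`Coset21.CharTwoKill.Phi`) kills an
atom as soon as `γ` matches its colour at ONE free bit (`Phi_atom_eq_zero`: the involution flipping that bit), and a colouring hitting
every atom on its own free bits exists by a union bound in which the non-free bits are free wildcards (`hits_exists_free`).  Result:
`abstract_even_existsC` — a cored strategy all of whose registers have `≥ m₁` free bits is not perfect once
`#cuts·2p^k·|W|·(2p−1)^{m₁}(2p)^{m−m₁} < (2p)^m`.  Part B instantiates it on the ring walk and at the quadratic grade.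
-/

open Finset
open Summit.QuantumAdvantage.AdviceFreeQNC0
open Summit.QuantumAdvantage.AdviceFreeQNC0.Coset21.CharTwoKill

namespace Summit.QuantumAdvantage.QuantumAdvantage.Theorems.CoSupportDial

/-! ### §1 The engine: atoms with a core, the one-bit kill, the wildcard union bound -/

section Engine

variable {p : ℕ} [Fact p.Prime] {K : Type*} [Field K] [CharP K 2]
variable {G : Type*} [Fintype G] {m k : ℕ} {W : Type*} [Fintype W] [DecidableEq W]
variable (ω ζ : K) (hω : IsPrimitiveRoot ω p)
variable (lam : G → Fin k → Fin m → ZMod p) (N : G → (Fin m → Bool) → W)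
  (F : G → (Fin k → ZMod p) → W → Bool) (κ : G → ℕ) (w : G → Fin m → ℕ)

/-- atoms `(g, w₀, (a, b))`: cut, core value `w₀`, frequency vector `a ∈ 𝔽_p^k`, cube-root exponent `b+1` -/
abbrev Atom (p : ℕ) (G : Type*) (k : ℕ) (W : Type*) := G × W × ((Fin k → ZMod p) × Fin 2)

/-- the `k`-form term underlying an atom (forgetting the core value) -/
def Atom.term (t : Atom p G k W) : TermK p G k := (t.1, t.2.2)

/-- the table of the strategy frozen at core value `w₀` -/
def tableAt (w₀ : W) : G → (Fin k → ZMod p) → Bool := fun g x => F g x w₀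

/-- the atom as a function on the cube: `[N_g u = w₀] · coefK · χ_z(u)` -/
noncomputable def atomFn (t : Atom p G k W) (u : Fin m → Bool) : K :=
  (if N t.1 u = t.2.1 then (1 : K) else 0) *
    (coefK ω ζ hω (tableAt F t.2.1) κ t.term * cubeChar (zvalK ω ζ hω lam w t.term) u)

/-- the `K`-valued expansion of the fire count of a cored strategy -/
noncomputable def WsumC (u : Fin m → Bool) : K := ∑ t : Atom p G k W, atomFn ω ζ hω lam N F κ w t u

/-- **the expansion:** the fire count of the cored strategy `g ↦ F g (k forms) (N g u)` is the sum of its atoms. -/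
theorem card_fire_eq_WsumC [DecidableEq G] (hp5 : 5 ≤ p) (hζ : IsPrimitiveRoot ζ 3) (u : Fin m → Bool) :
    (((univ.filter fun g : G => F g (kForm lam g u) (N g u) = true ∧ (κ g + wForm w g u) % 3 ≠ 0).card : ℕ) : K)
      = WsumC ω ζ hω lam N F κ w u := by
  classical
  rw [natCast_card_filter]
  unfold WsumC
  rw [Fintype.sum_prod_type]
  refine sum_congr rfl fun g _ => ?_
  rw [Fintype.sum_prod_type]
  -- insert the core value
  have hcore : (if (F g (kForm lam g u) (N g u) = true ∧ (κ g + wForm w g u) % 3 ≠ 0) then (1 : K) else 0)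
      = ∑ w₀ : W, (if N g u = w₀ then (1 : K) else 0) *
          (if (tableAt F w₀ g (kForm lam g u) = true ∧ (κ g + wForm w g u) % 3 ≠ 0) then (1 : K) else 0) := by
    rw [Finset.sum_eq_single (N g u)]
    · simp [tableAt]
    · intro w₀ _ hne
      rw [if_neg (Ne.symm hne), zero_mul]
    · intro h; exact absurd (mem_univ _) h
  rw [hcore]
  refine sum_congr rfl fun w₀ _ => ?_
  -- the `k`-form expansion of the frozen table (as in `Coset21.CharTwoKill.card_fire_eq_WsumK`)
  have hind : (if (tableAt F w₀ g (kForm lam g u) = true ∧ (κ g + wForm w g u) % 3 ≠ 0) then (1 : K) else 0)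
      = (if tableAt F w₀ g (kForm lam g u) = true then (1 : K) else 0)
          * (if (κ g + wForm w g u) % 3 ≠ 0 then (1 : K) else 0) := by
    rw [ite_zero_mul_ite_zero, one_mul]
  have hexp : (if (tableAt F w₀ g (kForm lam g u) = true ∧ (κ g + wForm w g u) % 3 ≠ 0) then (1 : K) else 0)
      = ∑ x : (Fin k → ZMod p) × Fin 2,
          coefK ω ζ hω (tableAt F w₀) κ (g, x) * cubeChar (zvalK ω ζ hω lam w (g, x)) u := by
    rw [hind, indicatorK_eq_sum ω hω lam (tableAt F w₀) hp5, live_eq hζ, Finset.sum_mul, Fintype.sum_prod_type]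
    refine sum_congr rfl fun a _ => ?_
    rw [Fin.sum_univ_two, ← termK_eq, ← termK_eq, mul_add]
    congr 3; simp
  rw [hexp, Finset.mul_sum]
  refine sum_congr rfl fun x _ => ?_
  rfl

/-- the colour of atom `t` at bit `i` (that of its underlying `k`-form term) -/
def colourC (t : Atom p G k W) (i : Fin m) : ZMod p × ℕ := colourK lam w t.term i

omit [Fintype G] [Fintype W] [DecidableEq W] in
/-- every colour lies in `𝔽_p × {1,2}` -/
theorem colourC_mem (hw : ∀ g i, w g i = 1 ∨ w g i = 2) (t : Atom p G k W) (i : Fin m) :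
    colourC lam w t i ∈ (univ : Finset (ZMod p)) ×ˢ ({1, 2} : Finset ℕ) :=
  colourK_mem lam w hw t.term i

omit [CharP K 2] in
/-- a cube character picks up the factor `z i` when bit `i` is switched on -/
theorem cubeChar_update_true (z : Fin m → K) (u : Fin m → Bool) (i : Fin m) :
    cubeChar z (Function.update u i true) = z i * cubeChar z (Function.update u i false) := by
  classical
  unfold cubeChar
  rw [← Finset.mul_prod_erase univ _ (mem_univ i), ← Finset.mul_prod_erase univ (fun j => if Function.update u i false j = true then z j else 1) (mem_univ i)]
  simp only [Function.update_self, if_true, Bool.false_eq_true, if_false, one_mul]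
  congr 1
  refine prod_congr rfl fun j hj => ?_
  rw [Function.update_of_ne (ne_of_mem_erase hj), Function.update_of_ne (ne_of_mem_erase hj)]

omit [CharP K 2] in
/-- the `Φ`-weight picks up the factor `γ i` when bit `i` is switched off -/
theorem phiWeight_update_false (γ : Fin m → K) (u : Fin m → Bool) (i : Fin m) :
    (∏ j, (if Function.update u i false j = true then (1 : K) else γ j))
      = γ i * ∏ j, (if Function.update u i true j = true then (1 : K) else γ j) := by
  classical
  rw [← Finset.mul_prod_erase univ _ (mem_univ i), ← Finset.mul_prod_erase univ (fun j => if Function.update u i true j = true then (1 : K) else γ j) (mem_univ i)]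
  simp only [Function.update_self, if_true, Bool.false_eq_true, if_false, one_mul]
  congr 1
  refine prod_congr rfl fun j hj => ?_
  rw [Function.update_of_ne (ne_of_mem_erase hj), Function.update_of_ne (ne_of_mem_erase hj)]

omit [Fintype G] [Fintype W] in
/-- **the one-bit kill.**  If bit `i` is FREE for the core of atom `t` (flipping it never changes `N`), and the colouring `γ` matches the
atom's colour at `i`, then `Φ_γ(atom) = 0`: pair `u` with `u ⊕ e_i`; the two contributions are `X·γ_i` and `X·z_i` with `z_i = γ_i`. -/
theorem Phi_atom_eq_zero (hζ : IsPrimitiveRoot ζ 3) (t : Atom p G k W) (i : Fin m)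
    (hfree : ∀ u b, N t.1 (Function.update u i b) = N t.1 u)
    (γ' : Fin m → ZMod p × ℕ) (hi : γ' i = colourC lam w t i) :
    Phi (fun j => gam ω ζ hω (γ' j)) (atomFn ω ζ hω lam N F κ w t) = 0 := by
  classical
  unfold Phi
  -- the involution flipping bit `i`
  refine Finset.sum_involution (fun u _ => Function.update u i (!u i)) ?_ ?_ ?_ ?_
  · -- paired terms cancel
    intro u _
    have hz : zvalK ω ζ hω lam w t.term i = gam ω ζ hω (γ' i) := by
      rw [zvalK_eq_gam ω ζ hω lam w hζ, hi]; rfl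
    set γ : Fin m → K := fun j => gam ω ζ hω (γ' j) with hγ
    have key : ∀ v : Fin m → Bool,
        atomFn ω ζ hω lam N F κ w t (Function.update v i false) * (∏ j, if Function.update v i false j = true then (1 : K) else γ j)
          + atomFn ω ζ hω lam N F κ w t (Function.update v i true) * (∏ j, if Function.update v i true j = true then (1 : K) else γ j)
          = 0 := by
      intro v
      unfold atomFn
      rw [cubeChar_update_true, phiWeight_update_false, hfree v false, hfree v true, hz]
      rw [CharTwo.add_eq_zero]
      simp only [hγ]
      ring
    have k0 := key u
    rcases Bool.eq_false_or_eq_true (u i) with hb | hb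
    · have h1 : Function.update u i true = u := by rw [← hb]; exact Function.update_eq_self i u
      rw [h1, add_comm] at k0
      rw [hb, Bool.not_true]
      exact k0
    · have h1 : Function.update u i false = u := by rw [← hb]; exact Function.update_eq_self i u
      rw [h1] at k0
      rw [hb, Bool.not_false]
      exact k0
  · -- the involution has no fixed points
    intro u _ _ heq
    have := congrFun heq i
    simp at this
  · intro u _; exact mem_univ _
  · intro u _
    funext j
    by_cases hj : j = i
    · subst hj; simp
    · simp [Function.update_of_ne hj]

/-- `Φ_γ` of the whole expansion vanishes for a colouring that hits every atom at one of its free bits -/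
theorem Phi_WsumC_eq_zero (hζ : IsPrimitiveRoot ζ 3) (free : G → Finset (Fin m))
    (hN : ∀ g, ∀ i ∈ free g, ∀ u b, N g (Function.update u i b) = N g u)
    (γ' : Fin m → ZMod p × ℕ) (hhit : ∀ t : Atom p G k W, ∃ i ∈ free t.1, γ' i = colourC lam w t i) :
    Phi (fun j => gam ω ζ hω (γ' j)) (WsumC ω ζ hω lam N F κ w) = 0 := by
  have hs : Phi (fun j => gam ω ζ hω (γ' j)) (WsumC ω ζ hω lam N F κ w)
      = ∑ t : Atom p G k W, Phi (fun j => gam ω ζ hω (γ' j)) (atomFn ω ζ hω lam N F κ w t) :=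
    Phi_sum univ _ _
  rw [hs]
  refine sum_eq_zero fun t _ => ?_
  obtain ⟨i, hi, hγi⟩ := hhit t
  exact Phi_atom_eq_zero ω ζ hω lam N F κ w hζ t i (hN t.1 i hi) γ' hγi

omit [Fintype W] [DecidableEq W] in
/-- the product `(c−1)^{|S|} · c^{m−|S|}` is antitone in `|S| ≥ m₁` -/
theorem pow_mul_pow_le {c m₁ f m : ℕ} (h₁ : m₁ ≤ f) (h₂ : f ≤ m) :
    (c - 1) ^ f * c ^ (m - f) ≤ (c - 1) ^ m₁ * c ^ (m - m₁) := by
  obtain ⟨d, rfl⟩ := Nat.exists_eq_add_of_le h₁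
  have hm : m - m₁ = d + (m - (m₁ + d)) := by omega
  rw [hm, pow_add, pow_add, mul_assoc]
  refine Nat.mul_le_mul_left _ (Nat.mul_le_mul_right _ ?_)
  exact Nat.pow_le_pow_left (Nat.sub_le c 1) d

omit [Fact p.Prime] [Fintype W] [DecidableEq W] in
/-- **the wildcard union bound.**  Atoms `t` with colour vectors `col t` and FREE sets `free t` of size `≥ m₁`: if
`#atoms · (|V|−1)^{m₁}·|V|^{m−m₁} < |V|^m`, some colouring `γ' ∈ V^m` matches every atom at one of ITS free bits (bits outside `free t` are
wildcards: they neither help nor cost). -/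
theorem hits_exists_free {T : Type*} [Fintype T] (V : Finset (ZMod p × ℕ)) (col : T → Fin m → ZMod p × ℕ)
    (free : T → Finset (Fin m)) (hV : ∀ t i, col t i ∈ V) (m₁ : ℕ) (hfree : ∀ t, m₁ ≤ (free t).card)
    (hcount : Fintype.card T * ((V.card - 1) ^ m₁ * V.card ^ (m - m₁)) < V.card ^ m) :
    ∃ γ' : Fin m → ZMod p × ℕ, (∀ i, γ' i ∈ V) ∧ ∀ t : T, ∃ i ∈ free t, γ' i = col t i := by
  classical
  set P := Fintype.piFinset (fun _ : Fin m => V) with hP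
  have hPcard : P.card = V.card ^ m := Fintype.card_piFinset_const V m
  -- the colourings missing atom `t` on all its free bits
  set bad : T → Finset (Fin m → ZMod p × ℕ) :=
    fun t => Fintype.piFinset (fun i => if i ∈ free t then V.erase (col t i) else V) with hbad
  have hbadcard : ∀ t, (bad t).card ≤ (V.card - 1) ^ m₁ * V.card ^ (m - m₁) := by
    intro t
    rw [hbad, Fintype.card_piFinset]
    have hprod : (∏ i : Fin m, (if i ∈ free t then V.erase (col t i) else V).card)
        = (V.card - 1) ^ (free t).card * V.card ^ (m - (free t).card) := by
      have h1 : ∀ i : Fin m, (if i ∈ free t then V.erase (col t i) else V).card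
          = if i ∈ free t then V.card - 1 else V.card := by
        intro i
        split_ifs with h
        · exact card_erase_of_mem (hV t i)
        · rfl
      simp_rw [h1]
      rw [Finset.prod_ite, prod_const, prod_const]
      congr 2
      · rw [Finset.filter_mem_eq_inter, univ_inter]
      · rw [Finset.filter_not, Finset.filter_mem_eq_inter, univ_inter, card_sdiff_of_subset (subset_univ _), card_univ,
          Fintype.card_fin]
    rw [hprod]
    exact pow_mul_pow_le (hfree t) (by simpa using (free t).card_le_univ)
  have hunion : (univ.biUnion bad).card < P.card := by
    calc (univ.biUnion bad).card ≤ ∑ t, (bad t).card := card_biUnion_le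
      _ ≤ ∑ _t : T, (V.card - 1) ^ m₁ * V.card ^ (m - m₁) := sum_le_sum fun t _ => hbadcard t
      _ = Fintype.card T * ((V.card - 1) ^ m₁ * V.card ^ (m - m₁)) := by rw [sum_const, smul_eq_mul, card_univ]
      _ < P.card := by rw [hPcard]; exact hcount
  obtain ⟨γ', hγP, hγbad⟩ : ∃ γ' ∈ P, γ' ∉ univ.biUnion bad := by
    by_contra hno
    push Not at hno
    exact absurd (card_le_card (fun x hx => hno x hx)) (not_le.mpr hunion)
  have hγV : ∀ i, γ' i ∈ V := by
    rw [hP, Fintype.mem_piFinset] at hγP; exact hγP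
  refine ⟨γ', hγV, fun t => ?_⟩
  have ht : γ' ∉ bad t := fun h => hγbad (mem_biUnion.mpr ⟨t, mem_univ _, h⟩)
  rw [hbad, Fintype.mem_piFinset] at ht
  push Not at ht
  obtain ⟨i, hi⟩ := ht
  by_cases hif : i ∈ free t
  · rw [if_pos hif, mem_erase, not_and_or, not_not] at hi
    rcases hi with hi | hi
    · exact ⟨i, hif, hi⟩
    · exact absurd (hγV i) hi
  · rw [if_neg hif] at hi
    exact absurd (hγV i) hi

omit [DecidableEq W] in
/-- the number of atoms is `#G · p^k · |W| · 2` -/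
theorem card_Atom : Fintype.card (Atom p G k W) = Fintype.card G * (p ^ k * Fintype.card W * 2) := by
  simp only [Atom, Fintype.card_prod, Fintype.card_fun, ZMod.card, Fintype.card_fin]
  ring

include ω hω in
/-- **Abstract LAW I.**  A cored strategy every register of which has `≥ m₁` free bits is not perfect once
`#G · 2p^k|W| · (2p−1)^{m₁} (2p)^{m−m₁} < (2p)^m`. -/
theorem abstract_even_existsC [DecidableEq G] (hp5 : 5 ≤ p) (hζ : IsPrimitiveRoot ζ 3)
    (hw : ∀ g i, w g i = 1 ∨ w g i = 2) (free : G → Finset (Fin m))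
    (hN : ∀ g, ∀ i ∈ free g, ∀ u b, N g (Function.update u i b) = N g u) (m₁ : ℕ) (hfree : ∀ g, m₁ ≤ (free g).card)
    (hcount : Fintype.card G * (p ^ k * Fintype.card W * 2) * ((2 * p - 1) ^ m₁ * (2 * p) ^ (m - m₁)) < (2 * p) ^ m) :
    ∃ u : Fin m → Bool,
      (univ.filter fun g : G => F g (kForm lam g u) (N g u) = true ∧ (κ g + wForm w g u) % 3 ≠ 0).card % 2 = 0 := by
  classical
  by_contra hall
  push Not at hall
  have hW : ∀ u, WsumC ω ζ hω lam N F κ w u = 1 := by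
    intro u
    rw [← card_fire_eq_WsumC ω ζ hω lam N F κ w hp5 hζ u]
    have hodd : (univ.filter fun g : G => F g (kForm lam g u) (N g u) = true ∧ (κ g + wForm w g u) % 3 ≠ 0).card % 2 = 1 := by
      have := hall u; omega
    rw [CharP.cast_eq_mod K 2, hodd, Nat.cast_one]
  set V : Finset (ZMod p × ℕ) := (univ : Finset (ZMod p)) ×ˢ ({1, 2} : Finset ℕ) with hVdef
  have hVcard : V.card = 2 * p := by
    rw [hVdef, card_product, card_univ, ZMod.card]
    simp
    ring
  have hcount' : Fintype.card (Atom p G k W) * ((V.card - 1) ^ m₁ * V.card ^ (m - m₁)) < V.card ^ m := by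
    rw [hVcard, card_Atom]; exact hcount
  obtain ⟨γ', hγV, hhit⟩ := hits_exists_free V (colourC lam w) (fun t : Atom p G k W => free t.1)
    (colourC_mem lam w hw) m₁ (fun t => hfree t.1) hcount'
  have hγ2 : ∀ i, (γ' i).2 % 3 ≠ 0 := by
    intro i
    have := hγV i
    rw [hVdef, mem_product] at this
    rcases this with ⟨-, h2⟩
    simp only [mem_insert, mem_singleton] at h2
    rcases h2 with h2 | h2 <;> omega
  have hzero := Phi_WsumC_eq_zero ω ζ hω lam N F κ w hζ free hN γ' hhit
  have hfun : WsumC ω ζ hω lam N F κ w = fun _ => (1 : K) := funext hW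
  rw [hfun, Phi_one] at hzero
  exact (prod_ne_zero_iff.mpr fun i _ => one_add_gam_ne_zero ω ζ hω hp5 hζ (γ' i) (hγ2 i)) hzero

end Engine

end Summit.QuantumAdvantage.QuantumAdvantage.Theorems.CoSupportDial
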